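import Mathlib.Data.Fintype.BigOperators
import Mathlib.Data.Nat.Choose.Central
import Literature.Computability.AlgebraicComplexity.SimultaneousDoubleProduct
import HarnessLib

/-!
# CKSU 2005, Prop. 4.5: the best known SDPP construction, in `Cyc_m^{2ℓ}`

Topic `Literature/Computability/AlgebraicComplexity`; companion of `SimultaneousDoubleProduct.lean`
(the simultaneous double product property `IsSDPP`, Cohn–Kleinberg–Szegedy–Umans 2005, §4, Def. 4.1),
whose docstring lists "Prop. 4.5 (the `C_m^{2ℓ}` construction)" as not yet vendored. Source: H. Cohn,
R. Kleinberg, B. Szegedy, C. Umans, *Group-theoretic algorithms for matrix multiplication*, FOCS 2005,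
§4, Proposition 4.5 (= "Proposition 24" of the arXiv text math/0511460, held as
`paper:arxiv-math_0511460`, chunk p0008 L45–80), read this session:

"**The best construction we know is the following: Proposition 4.5.** For each `m ≥ 2`, there is a
construction in `Cyc_m^{2ℓ}` satisfying the simultaneous double product property with
`α = log₂(m−1) + o(1)` and `β = log₂ m + o(1)` as `ℓ → ∞`. Taking `m = 6` yields exactly the same
bound as in Subsection 3.3 (`ω < 2.48`). *Proof.* Let `n = binom(2ℓ, ℓ)`. … For each subset `S` of
the `2ℓ` coordinates of `Cyc_m^{2ℓ}` with `|S| = ℓ`, let `A_S` be the set of elements that are nonzero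
in those coordinates and zero in the others. Let `S̄` denote the complement of `S`, and set
`B_S = A_{S̄}`. For each `S`, we have `|A_S||B_S| = (m−1)^{2ℓ}` … Each pair `A_S, B_S` clearly
satisfies the double product property, because the elements of `A_S` and `B_S` are supported on
disjoint sets of coordinates. Each element of `B_S − A_S` is nonzero in every coordinate, but if
`Q ≠ R` then there is a coordinate in `R̄ ∩ Q` (note that this is why we require `|Q| = |R|`). Each
element of `B_Q − A_R` vanishes in that coordinate, so `(B_Q − A_R) ∩ (B_S − A_S) = ∅` as desired."

(Here `α, β` are the parameters of §4: `n` pairs with `|Aᵢ||Bᵢ| ≥ n^α` in a group of order `n^β`;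
for abelian `H` Thm. 4.4 gives `ω ≤ (3β − 2)/α`.)

## Formalisation

* `supportSet C S` — the set `A_S ⊆ (Fin k → C)` of vectors that are non-zero exactly on `S`, for any
  finite additive abelian group `C` in place of `Cyc_m` (`m := |C|`; the proof uses only the
  coordinate structure) and any number `k` of coordinates; `card_supportSet`: `|A_S| = (m−1)^{|S|}`.
* `isSDPP_supportSet` — **the proof as printed**, for any injective family `S : Fin n → Finset (Fin k)`
  of index sets of a common size `r` (the paper's `k = 2ℓ`, `r = ℓ`): the pairs `(A_{Sᵢ}, A_{S̄ᵢ})`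
  satisfy the tree's `IsSDPP` (additive form of Def. 4.1): clause (W) coordinatewise from the disjoint
  supports, clause (X) through a coordinate in `S_k ∖ S_i`.
* `card_supportSet_mul_card_compl` — `|A_S||B_S| = (m−1)^k`; `CohnKleinbergSzegedyUmans2005_prop24` —
  the statement: for every `ℓ` there are `n = binom(2ℓ, ℓ)` SDPP pairs in `C^{2ℓ}` (order `m^{2ℓ}`)
  with `|Aᵢ||Bᵢ| = (m−1)^{2ℓ}` each. The asymptotic reading `α = log₂(m−1) + o(1)`,
  `β = log₂ m + o(1)` follows from `4^ℓ ≤ 2ℓ · binom(2ℓ, ℓ)` (Mathlib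
  `Nat.four_pow_le_two_mul_self_mul_centralBinom`) and is not restated.

Theorems only, 0 named facts. What is NOT here: Thm. 4.3 / 4.4 (SDPP ⇒ TPP in the wreath product
`(H³)^{Δₙ} ⋊ Sym(Δₙ)` and the resulting `ω`-bound; the proof of Thm. 4.3 is deferred to the paper's
unpublished full version), hence no `ω ≤ 2.48` is derived along this route here (the tree has that
value by the strong-USP route of §3.3, `Summit.MatrixMultiplication.OmegaCensus.omega_le_of_cksuProp18`).
-/

namespace Literature.Computability.AlgebraicComplexity

open Finset

namespace SDPPCyclicPower

variable (C : Type*) [AddCommGroup C] [Fintype C] [DecidableEq C] {k : ℕ}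

/-- **`A_S`**: "the set of elements [of `C^k`] that are nonzero in those coordinates [`S`] and zero in
the others". [cite: CohnKleinbergSzegedyUmans2005, Prop. 4.5 (arXiv Prop. 24), proof] -/
def supportSet (S : Finset (Fin k)) : Finset (Fin k → C) :=
  Fintype.piFinset fun c => if c ∈ S then (Finset.univ : Finset C).erase 0 else {0}

variable {C}

/-- Membership in `A_S`: non-zero on `S`, zero off `S`.
[cite: CohnKleinbergSzegedyUmans2005, Prop. 4.5 (arXiv Prop. 24), proof] -/
theorem mem_supportSet {S : Finset (Fin k)} {x : Fin k → C} :
    x ∈ supportSet C S ↔ ∀ c, (c ∈ S → x c ≠ 0) ∧ (c ∉ S → x c = 0) := by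
  simp only [supportSet, Fintype.mem_piFinset]
  refine forall_congr' fun c => ?_
  split_ifs with hc <;> simp [hc]

/-- `|A_S| = (m − 1)^{|S|}`, `m = |C|`. [cite: CohnKleinbergSzegedyUmans2005, Prop. 4.5 (arXiv Prop. 24), proof] -/
theorem card_supportSet (S : Finset (Fin k)) :
    (supportSet C S).card = (Fintype.card C - 1) ^ S.card := by
  rw [supportSet, Fintype.card_piFinset]
  simp only [apply_ite Finset.card, Finset.card_erase_of_mem (Finset.mem_univ _), Finset.card_univ,
    Finset.card_singleton, Finset.prod_ite_mem, Finset.univ_inter, Finset.prod_const]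

/-- "`|A_S||B_S| = (m−1)^{2ℓ}`": with `B_S = A_{S̄}`, `|A_S| |A_{S̄}| = (m − 1)^k`.
[cite: CohnKleinbergSzegedyUmans2005, Prop. 4.5 (arXiv Prop. 24), proof] -/
theorem card_supportSet_mul_card_compl (S : Finset (Fin k)) :
    (supportSet C S).card * (supportSet C Sᶜ).card = (Fintype.card C - 1) ^ k := by
  rw [card_supportSet, card_supportSet, ← pow_add, Finset.card_add_card_compl, Fintype.card_fin]

/-- **CKSU 2005, Prop. 4.5 — the proof.** For an injective family `S : Fin n → Finset (Fin k)` of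
coordinate sets of a common size `r`, the pairs `(A_{Sᵢ}, B_{Sᵢ}) = (A_{Sᵢ}, A_{S̄ᵢ})` in `C^k` satisfy
the simultaneous double product property: (W) "the elements of `A_S` and `B_S` are supported on
disjoint sets of coordinates"; (X) "if `Q ≠ R` then there is a coordinate in `R̄ ∩ Q` (note that this
is why we require `|Q| = |R|`). Each element of `B_Q − A_R` vanishes in that coordinate", while each
element of `B_S − A_S` is non-zero in every coordinate.
[cite: CohnKleinbergSzegedyUmans2005, Prop. 4.5 (arXiv Prop. 24)] -/
theorem isSDPP_supportSet {n r : ℕ} (S : Fin n → Finset (Fin k)) (hS : Function.Injective S)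
    (hr : ∀ i, (S i).card = r) :
    IsSDPP (fun i => supportSet C (S i)) (fun i => supportSet C (S i)ᶜ) := by
  refine ⟨fun i a ha a' ha' b hb b' hb' h0 => ?_, fun i j l a ha a' ha' b hb b' hb' h0 => ?_⟩
  · -- (W): disjoint supports
    rw [mem_supportSet] at ha ha' hb hb'
    have hc : ∀ c, (a c - a' c) + (b c - b' c) = 0 := fun c => by
      simpa only [Pi.add_apply, Pi.sub_apply, Pi.zero_apply] using congrFun h0 c
    refine ⟨funext fun c => ?_, funext fun c => ?_⟩
    · by_cases hcS : c ∈ S i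
      · have hb0 : b c = 0 := (hb c).2 (by simpa using hcS)
        have hb'0 : b' c = 0 := (hb' c).2 (by simpa using hcS)
        have := hc c
        rw [hb0, hb'0, sub_zero, add_zero] at this
        exact sub_eq_zero.mp this
      · rw [(ha c).2 hcS, (ha' c).2 hcS]
    · by_cases hcS : c ∈ S i
      · rw [(hb c).2 (by simpa using hcS), (hb' c).2 (by simpa using hcS)]
      · have := hc c
        rw [(ha c).2 hcS, (ha' c).2 hcS, sub_zero, zero_add] at this
        exact sub_eq_zero.mp this
  · -- (X): a coordinate in `S l ∖ S i`
    by_contra hil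
    have hne : S l ≠ S i := fun e => hil (hS e).symm
    have hnot : ¬ S l ⊆ S i := fun hsub =>
      hne (Finset.eq_of_subset_of_card_le hsub (by rw [hr, hr]))
    obtain ⟨c, hcl, hci⟩ := Finset.not_subset.mp hnot
    rw [mem_supportSet] at ha ha' hb hb'
    have hc : (a c - a' c) + (b c - b' c) = 0 := by
      simpa only [Pi.add_apply, Pi.sub_apply, Pi.zero_apply] using congrFun h0 c
    rw [(ha c).2 hci, (hb' c).2 (by simpa using hcl), zero_sub, sub_zero] at hc
    -- `hc : -a' c + b c = 0`
    by_cases hcj : c ∈ S j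
    · have h2 : b c = 0 := (hb c).2 (by simpa using hcj)
      rw [h2, add_zero, neg_eq_zero] at hc
      exact (ha' c).1 hcj hc
    · have h1 : a' c = 0 := (ha' c).2 hcj
      rw [h1, neg_zero, zero_add] at hc
      exact (hb c).1 (by simpa using hcj) hc

end SDPPCyclicPower

open SDPPCyclicPower in
/-- **Cohn–Kleinberg–Szegedy–Umans 2005, Proposition 4.5 (arXiv Prop. 24), "the best construction we
know":** for every finite abelian group `C` of order `m` (the paper: `Cyc_m`, `m ≥ 2`) and every `ℓ`,
the group `C^{2ℓ}` (order `m^{2ℓ}`) contains `n = binom(2ℓ, ℓ)` pairs `(Aᵢ, Bᵢ)` with the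
simultaneous double product property and `|Aᵢ||Bᵢ| = (m − 1)^{2ℓ}` for every `i` — namely
`A_S`, `B_S = A_{S̄}` over the `ℓ`-subsets `S` of the `2ℓ` coordinates (so `α = log₂(m−1) + o(1)`,
`β = log₂ m + o(1)` as `ℓ → ∞`, by `4^ℓ ≤ 2ℓ·binom(2ℓ,ℓ)`).
[cite: CohnKleinbergSzegedyUmans2005, Prop. 4.5 (arXiv Prop. 24)] -/
theorem CohnKleinbergSzegedyUmans2005_prop24 (C : Type*) [AddCommGroup C] [Fintype C] [DecidableEq C]
    (ℓ : ℕ) :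
    ∃ A B : Fin ((2 * ℓ).choose ℓ) → Finset (Fin (2 * ℓ) → C),
      IsSDPP A B ∧ ∀ i, (A i).card * (B i).card = (Fintype.card C - 1) ^ (2 * ℓ) := by
  classical
  -- index the `ℓ`-subsets of `Fin (2ℓ)` by `Fin (binom(2ℓ, ℓ))`
  set T := (Finset.univ : Finset (Fin (2 * ℓ))).powersetCard ℓ with hT
  have hcard : Fintype.card T = (2 * ℓ).choose ℓ := by
    rw [Fintype.card_coe, hT, Finset.card_powersetCard, Finset.card_univ, Fintype.card_fin]
  let e : T ≃ Fin ((2 * ℓ).choose ℓ) := Fintype.equivFinOfCardEq hcard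
  let S : Fin ((2 * ℓ).choose ℓ) → Finset (Fin (2 * ℓ)) := fun i => (e.symm i : T)
  have hS : Function.Injective S := fun i j h =>
    e.symm.injective (Subtype.ext h)
  have hr : ∀ i, (S i).card = ℓ := fun i =>
    (Finset.mem_powersetCard.mp (e.symm i).2).2
  exact ⟨fun i => supportSet C (S i), fun i => supportSet C (S i)ᶜ, isSDPP_supportSet S hS hr,
    fun i => card_supportSet_mul_card_compl (S i)⟩

open SDPPCyclicPower in
/-- The ambient group of Prop. 4.5 has order `m^{2ℓ}` (`β = log₂ m + o(1)` with `n = binom(2ℓ, ℓ)`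
pairs). [cite: CohnKleinbergSzegedyUmans2005, Prop. 4.5 (arXiv Prop. 24)] -/
theorem card_fun_fin_two_mul (C : Type*) [Fintype C] (ℓ : ℕ) :
    Fintype.card (Fin (2 * ℓ) → C) = Fintype.card C ^ (2 * ℓ) := by
  rw [Fintype.card_fun, Fintype.card_fin]

end Literature.Computability.AlgebraicComplexity
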